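import Mathlib.Analysis.Normed.Ring.InfiniteSum
import Mathlib.Analysis.SpecialFunctions.Exponential
import Mathlib.Analysis.SpecialFunctions.Integrals.Basic
import Mathlib.Analysis.Complex.Exponential
import Mathlib.MeasureTheory.Integral.IntervalIntegral.Basic
import Mathlib.MeasureTheory.Integral.DominatedConvergence
import Mathlib.Topology.Algebra.InfiniteSum.Real
import Literature.Analysis.Toeplitz.StrongSzego
import Literature.Analysis.Toeplitz.ToeplitzHankel
import HarnessLib

/-!
# One-sided absolutely convergent trigonometric series and their exponentials

Topic `Analysis/Toeplitz`, namespace `Literature.Analysis.Toeplitz`. The symbol calculus of the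
Wiener–Hopf factors `φ₊ = e^{V₊}`, `φ₋ = e^{V₋}` in the proof of the strong Szegő limit theorem for
symbols with geometrically decaying Fourier coefficients (`StrongSzegoGeometric.lean`;
Deift–Its–Krasovsky 2013, §3), done entirely at the level of ONE-SIDED coefficient sequences
`x : ℕ → ℂ` with `∑ ‖x n‖ < ∞` and the function `ser x θ = ∑ x n e^{inθ}` they define:

* weighted norms `wn σ x = ∑ ‖x n‖ σ^{-n}` (`IsSumW σ x`), submultiplicative under the Cauchy
  product (`wn_cauchyProd_le`), powers `cpow x j` and the **exponential sequence**
  `expSeq x n = ∑_j (j!)⁻¹ (x^{⋆j}) n` with the geometric bounds `isGeom_expSeq`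
  (`‖expSeq x n‖ ≤ e^{wn σ x} σⁿ`), `isGeom_expSeq_sub_delta` (first order),
  `isGeom_expSeq_sub_delta_sub` (second order);
* `ser x θ`: continuity, `ser_cauchyProd : ser (x ⋆ y) = ser x · ser y` (Mertens/Cauchy, Mathlib's
  `tsum_mul_tsum_eq_tsum_sum_antidiagonal_of_summable_norm`), `ser_cpow`, and
  **`exp_ser : exp (ser x θ) = ser (expSeq x) θ`**;
* coefficient extraction `circleCoeff_ser : circleCoeff (ser x) m = extendZ x m` (termwise
  integration and orthogonality `integral_exp_int_mul_I`), hence `ser` is injective on `ℓ¹`;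
* the **group law** `cauchyProd_expSeq_smul : expSeq (s•x) ⋆ expSeq (t•x) = expSeq ((s+t)•x)` and
  `expSeq_zero : expSeq 0 = δ₀`, `expSeq_apply_zero : x 0 = 0 → expSeq x 0 = 1`.

No power-series algebra is used: identities between coefficient sequences are proved by comparing
the functions they sum to and extracting coefficients.

## References

* P. Deift, A. Its, I. Krasovsky, Comm. Pure Appl. Math. 66 (2013) 1360–1438, §3 (`φ = φ₊φ₋`,
  `φ± = e^{V±}`).
-/

noncomputable section

open Finset Filter Complex MeasureTheory intervalIntegral
open scoped _root_.Topology BigOperators Real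

namespace Literature.Analysis.Toeplitz

/-! ### Weighted norms of one-sided sequences -/

/-- **Weighted summability** `∑ ‖x n‖ σ^{-n} < ∞` (for `σ = 1`: absolute summability). [folklore] -/
def IsSumW (σ : ℝ) (x : ℕ → ℂ) : Prop := Summable fun n => ‖x n‖ * σ⁻¹ ^ n

/-- The weighted norm `∑ ‖x n‖ σ^{-n}`. [folklore] -/
def wn (σ : ℝ) (x : ℕ → ℂ) : ℝ := ∑' n, ‖x n‖ * σ⁻¹ ^ n

section Weighted

variable {σ : ℝ} {x y : ℕ → ℂ}

/-- The weighted norm is nonnegative (`σ ≥ 0`). [folklore] -/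
theorem wn_nonneg (hσ : 0 ≤ σ) (x : ℕ → ℂ) : 0 ≤ wn σ x :=
  tsum_nonneg fun _ => mul_nonneg (norm_nonneg _) (pow_nonneg (inv_nonneg.2 hσ) _)

/-- **Pointwise bound** `‖x n‖ ≤ wn σ x · σⁿ`, i.e. `IsGeom σ (wn σ x) x` (`σ > 0`). [folklore] -/
theorem IsSumW.isGeom (hx : IsSumW σ x) (hσ : 0 < σ) : IsGeom σ (wn σ x) x := by
  intro n
  have h := hx.le_tsum n fun m _ => mul_nonneg (norm_nonneg _) (pow_nonneg (inv_nonneg.2 hσ.le) _)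
  rw [wn]
  calc ‖x n‖ = ‖x n‖ * σ⁻¹ ^ n * σ ^ n := by rw [inv_pow, mul_assoc, inv_mul_cancel₀ (pow_ne_zero _ hσ.ne'), mul_one]
    _ ≤ (∑' m, ‖x m‖ * σ⁻¹ ^ m) * σ ^ n := mul_le_mul_of_nonneg_right h (pow_nonneg hσ.le _)

/-- Weighted summability implies absolute summability (`0 < σ ≤ 1`). [folklore] -/
theorem IsSumW.summable_norm (hx : IsSumW σ x) (hσ : 0 < σ) (hσ1 : σ ≤ 1) : Summable fun n => ‖x n‖ :=
  Summable.of_nonneg_of_le (fun _ => norm_nonneg _) (fun _ => le_mul_of_one_le_right (norm_nonneg _)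
    (one_le_pow₀ (one_le_inv_iff₀.2 ⟨hσ, hσ1⟩))) hx

/-- At `σ = 1` the weighted norm is the `ℓ¹` norm. [folklore] -/
theorem isSumW_one_iff : IsSumW 1 x ↔ Summable fun n => ‖x n‖ := by
  simp [IsSumW]

/-- At `σ = 1`, `wn 1 x = ∑ ‖x n‖`. [folklore] -/
theorem wn_one (x : ℕ → ℂ) : wn 1 x = ∑' n, ‖x n‖ := by simp [wn]

/-- **A geometric sequence is weighted-summable at every larger rate**, with
`wn σ x ≤ D / (1 - r/σ)`. [folklore] -/
theorem isSumW_of_isGeom {r D : ℝ} (hx : IsGeom r D x) (hr : 0 ≤ r) (hσ : 0 < σ) (hrσ : r < σ) :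
    IsSumW σ x ∧ wn σ x ≤ D / (1 - r / σ) := by
  have hq : r / σ < 1 := (div_lt_one hσ).2 hrσ
  have hq0 : 0 ≤ r / σ := div_nonneg hr hσ.le
  have hgeo := summable_geometric_of_lt_one hq0 hq
  have hle : ∀ n, ‖x n‖ * σ⁻¹ ^ n ≤ D * (r / σ) ^ n := fun n => by
    calc ‖x n‖ * σ⁻¹ ^ n ≤ D * r ^ n * σ⁻¹ ^ n :=
          mul_le_mul_of_nonneg_right (hx n) (pow_nonneg (inv_nonneg.2 hσ.le) _)
      _ = D * (r / σ) ^ n := by rw [div_eq_mul_inv, mul_pow]; ring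
  have hs : IsSumW σ x := Summable.of_nonneg_of_le (fun n => mul_nonneg (norm_nonneg _)
    (pow_nonneg (inv_nonneg.2 hσ.le) _)) hle (hgeo.mul_left D)
  refine ⟨hs, ?_⟩
  calc wn σ x ≤ ∑' n, D * (r / σ) ^ n := hs.tsum_le_tsum hle (hgeo.mul_left D)
    _ = D / (1 - r / σ) := by rw [tsum_mul_left, tsum_geometric_of_lt_one hq0 hq, ← div_eq_mul_inv]

/-- Sums. [folklore] -/
theorem IsSumW.add (hx : IsSumW σ x) (hy : IsSumW σ y) (hσ : 0 ≤ σ) : IsSumW σ (x + y) := by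
  have hle : ∀ n, ‖(x + y) n‖ * σ⁻¹ ^ n ≤ ‖x n‖ * σ⁻¹ ^ n + ‖y n‖ * σ⁻¹ ^ n := fun n => by
    rw [Pi.add_apply, ← add_mul]
    exact mul_le_mul_of_nonneg_right (norm_add_le _ _) (pow_nonneg (inv_nonneg.2 hσ) _)
  exact Summable.of_nonneg_of_le (fun _ => mul_nonneg (norm_nonneg _) (pow_nonneg (inv_nonneg.2 hσ) _))
    hle (Summable.add hx hy)

/-- The weighted norm is subadditive. [folklore] -/
theorem wn_add_le (hx : IsSumW σ x) (hy : IsSumW σ y) (hσ : 0 ≤ σ) : wn σ (x + y) ≤ wn σ x + wn σ y := by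
  rw [wn, wn, wn, ← Summable.tsum_add hx hy]
  refine (hx.add hy hσ).tsum_le_tsum (fun n => ?_) (Summable.add hx hy)
  rw [Pi.add_apply, ← add_mul]
  exact mul_le_mul_of_nonneg_right (norm_add_le _ _) (pow_nonneg (inv_nonneg.2 hσ) _)

/-- Scalar multiples. [folklore] -/
theorem IsSumW.smul (hx : IsSumW σ x) (t : ℂ) : IsSumW σ (t • x) := by
  have := hx.mul_left ‖t‖
  refine this.congr fun n => ?_
  rw [Pi.smul_apply, smul_eq_mul, norm_mul, mul_assoc]

/-- The weighted norm is absolutely homogeneous. [folklore] -/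
theorem wn_smul (t : ℂ) (x : ℕ → ℂ) : wn σ (t • x) = ‖t‖ * wn σ x := by
  rw [wn, wn, ← tsum_mul_left]
  exact tsum_congr fun n => by rw [Pi.smul_apply, smul_eq_mul, norm_mul, mul_assoc]

/-- Negation. [folklore] -/
theorem IsSumW.neg (hx : IsSumW σ x) : IsSumW σ (-x) := by
  refine hx.congr fun n => ?_; rw [Pi.neg_apply, norm_neg]

/-- The weighted norm is even. [folklore] -/
theorem wn_neg (x : ℕ → ℂ) : wn σ (-x) = wn σ x := by
  rw [wn, wn]; exact tsum_congr fun n => by rw [Pi.neg_apply, norm_neg]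

/-- Differences. [folklore] -/
theorem IsSumW.sub (hx : IsSumW σ x) (hy : IsSumW σ y) (hσ : 0 ≤ σ) : IsSumW σ (x - y) := by
  rw [sub_eq_add_neg]; exact hx.add hy.neg hσ

/-- The zero sequence. [folklore] -/
theorem IsSumW.zero (σ : ℝ) : IsSumW σ (0 : ℕ → ℂ) := by
  simp [IsSumW]

/-- `wn σ 0 = 0`. [folklore] -/
@[simp] theorem wn_zero' (σ : ℝ) : wn σ (0 : ℕ → ℂ) = 0 := by simp [wn]

/-- `δ₀` is weighted-summable. [folklore] -/
theorem isSumW_delta (σ : ℝ) : IsSumW σ delta := by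
  refine summable_of_ne_finset_zero (s := {0}) fun n hn => ?_
  rw [mem_singleton] at hn
  rw [delta_of_ne_zero hn, norm_zero, zero_mul]

/-- `wn σ δ₀ = 1`. [folklore] -/
@[simp] theorem wn_delta (σ : ℝ) : wn σ delta = 1 := by
  rw [wn, tsum_eq_single 0]
  · simp
  · intro n hn; rw [delta_of_ne_zero hn, norm_zero, zero_mul]

/-- Monotonicity of weighted summability under a pointwise bound. [folklore] -/
theorem IsSumW.of_norm_le (hy : IsSumW σ y) (hσ : 0 ≤ σ) (h : ∀ n, ‖x n‖ ≤ ‖y n‖) : IsSumW σ x :=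
  Summable.of_nonneg_of_le (fun _ => mul_nonneg (norm_nonneg _) (pow_nonneg (inv_nonneg.2 hσ) _))
    (fun n => mul_le_mul_of_nonneg_right (h n) (pow_nonneg (inv_nonneg.2 hσ) _)) hy

/-- Monotonicity of the weighted norm under a pointwise bound. [folklore] -/
theorem wn_mono (hy : IsSumW σ y) (hσ : 0 ≤ σ) (h : ∀ n, ‖x n‖ ≤ ‖y n‖) : wn σ x ≤ wn σ y :=
  (hy.of_norm_le hσ h).tsum_le_tsum (fun n => mul_le_mul_of_nonneg_right (h n)
    (pow_nonneg (inv_nonneg.2 hσ) _)) hy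

end Weighted

/-! ### The Cauchy product in the weighted norm -/

section CauchyProd

variable {σ : ℝ} {x y : ℕ → ℂ}

/-- The pointwise estimate `‖(x ⋆ y) n‖ σ^{-n} ≤ ∑_{k+l=n} (‖x k‖ σ^{-k})(‖y l‖ σ^{-l})`. [folklore] -/
theorem norm_cauchyProd_mul_pow_le {σ : ℝ} (hσ : 0 ≤ σ) (x y : ℕ → ℂ) (n : ℕ) :
    ‖cauchyProd x y n‖ * σ⁻¹ ^ n ≤
      ∑ kl ∈ antidiagonal n, (‖x kl.1‖ * σ⁻¹ ^ kl.1) * (‖y kl.2‖ * σ⁻¹ ^ kl.2) := by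
  rw [cauchyProd]
  calc ‖∑ kl ∈ antidiagonal n, x kl.1 * y kl.2‖ * σ⁻¹ ^ n
      ≤ (∑ kl ∈ antidiagonal n, ‖x kl.1 * y kl.2‖) * σ⁻¹ ^ n :=
        mul_le_mul_of_nonneg_right (norm_sum_le _ _) (pow_nonneg (inv_nonneg.2 hσ) _)
    _ = ∑ kl ∈ antidiagonal n, ‖x kl.1‖ * ‖y kl.2‖ * σ⁻¹ ^ n := by
        rw [sum_mul]; exact sum_congr rfl fun kl _ => by rw [norm_mul]
    _ = ∑ kl ∈ antidiagonal n, (‖x kl.1‖ * σ⁻¹ ^ kl.1) * (‖y kl.2‖ * σ⁻¹ ^ kl.2) := by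
        refine sum_congr rfl fun kl hkl => ?_
        rw [mem_antidiagonal] at hkl
        rw [← hkl, pow_add]; ring

/-- **Submultiplicativity**: the Cauchy product of weighted-summable sequences is weighted-summable,
with `wn σ (x ⋆ y) ≤ wn σ x · wn σ y`. [folklore] -/
theorem IsSumW.cauchyProd (hx : IsSumW σ x) (hy : IsSumW σ y) (hσ : 0 < σ) :
    IsSumW σ (Toeplitz.cauchyProd x y) ∧ wn σ (Toeplitz.cauchyProd x y) ≤ wn σ x * wn σ y := by
  set f : ℕ → ℝ := fun n => ‖x n‖ * σ⁻¹ ^ n with hf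
  set g : ℕ → ℝ := fun n => ‖y n‖ * σ⁻¹ ^ n with hg
  have hf0 : ∀ n, 0 ≤ f n := fun n => mul_nonneg (norm_nonneg _) (pow_nonneg (inv_nonneg.2 hσ.le) _)
  have hg0 : ∀ n, 0 ≤ g n := fun n => mul_nonneg (norm_nonneg _) (pow_nonneg (inv_nonneg.2 hσ.le) _)
  have hfn : Summable fun n => ‖f n‖ := hx.congr fun n => (Real.norm_of_nonneg (hf0 n)).symm
  have hgn : Summable fun n => ‖g n‖ := hy.congr fun n => (Real.norm_of_nonneg (hg0 n)).symm
  have hprod := tsum_mul_tsum_eq_tsum_sum_antidiagonal_of_summable_norm hfn hgn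
  have hsum : Summable fun n => ∑ kl ∈ antidiagonal n, f kl.1 * g kl.2 := by
    have := summable_norm_sum_mul_antidiagonal_of_summable_norm hfn hgn
    refine this.congr fun n => Real.norm_of_nonneg (sum_nonneg fun kl _ => mul_nonneg (hf0 _) (hg0 _))
  have hle : ∀ n, ‖Toeplitz.cauchyProd x y n‖ * σ⁻¹ ^ n ≤ ∑ kl ∈ antidiagonal n, f kl.1 * g kl.2 :=
    norm_cauchyProd_mul_pow_le hσ.le x y
  have hs : IsSumW σ (Toeplitz.cauchyProd x y) := Summable.of_nonneg_of_le (fun n => mul_nonneg (norm_nonneg _)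
    (pow_nonneg (inv_nonneg.2 hσ.le) _)) hle hsum
  refine ⟨hs, ?_⟩
  calc wn σ (Toeplitz.cauchyProd x y) ≤ ∑' n, ∑ kl ∈ antidiagonal n, f kl.1 * g kl.2 := hs.tsum_le_tsum hle hsum
    _ = wn σ x * wn σ y := hprod.symm

/-- The Cauchy product of absolutely summable sequences is absolutely summable. [folklore] -/
theorem summable_norm_cauchyProd (hx : Summable fun n => ‖x n‖) (hy : Summable fun n => ‖y n‖) :
    Summable fun n => ‖cauchyProd x y n‖ := by
  have h := (IsSumW.cauchyProd (σ := 1) (isSumW_one_iff.2 hx) (isSumW_one_iff.2 hy) one_pos).1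
  exact isSumW_one_iff.1 h

end CauchyProd

/-! ### Convolution powers and the exponential sequence -/

/-- Convolution powers `x^{⋆j}`: `x^{⋆0} = δ₀`, `x^{⋆(j+1)} = x ⋆ x^{⋆j}`. [folklore] -/
def cpow (x : ℕ → ℂ) : ℕ → ℕ → ℂ
  | 0 => delta
  | j + 1 => cauchyProd x (cpow x j)

/-- `x^{⋆0} = δ₀`. [folklore] -/
@[simp] theorem cpow_zero (x : ℕ → ℂ) : cpow x 0 = delta := rfl

/-- `x^{⋆(j+1)} = x ⋆ x^{⋆j}`. [folklore] -/
@[simp] theorem cpow_succ (x : ℕ → ℂ) (j : ℕ) : cpow x (j + 1) = cauchyProd x (cpow x j) := rfl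

section Powers

variable {σ : ℝ} {x : ℕ → ℂ}

/-- **Convolution powers are weighted-summable**, `wn σ (x^{⋆j}) ≤ (wn σ x)^j`. [folklore] -/
theorem isSumW_cpow (hx : IsSumW σ x) (hσ : 0 < σ) (j : ℕ) :
    IsSumW σ (cpow x j) ∧ wn σ (cpow x j) ≤ wn σ x ^ j := by
  induction j with
  | zero => exact ⟨isSumW_delta σ, by simp⟩
  | succ j ih =>
    obtain ⟨h1, h2⟩ := hx.cauchyProd ih.1 hσ
    refine ⟨h1, h2.trans ?_⟩
    rw [pow_succ']
    exact mul_le_mul_of_nonneg_left ih.2 (wn_nonneg hσ.le x)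

/-- The pointwise bound `‖x^{⋆j} n‖ ≤ (wn σ x)^j σⁿ`. [folklore] -/
theorem norm_cpow_le (hx : IsSumW σ x) (hσ : 0 < σ) (j n : ℕ) :
    ‖cpow x j n‖ ≤ wn σ x ^ j * σ ^ n :=
  ((isSumW_cpow hx hσ j).1.isGeom hσ n).trans
    (mul_le_mul_of_nonneg_right (isSumW_cpow hx hσ j).2 (pow_nonneg hσ.le _))

/-- The powers of the zero sequence vanish in positive degree. [folklore] -/
theorem cpow_zero_seq_succ (j : ℕ) : cpow (0 : ℕ → ℂ) (j + 1) = 0 := by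
  funext n; simp [cauchyProd]

/-- The powers of a sequence with `x 0 = 0` vanish at `0` in positive degree. [folklore] -/
theorem cpow_apply_zero_of {x : ℕ → ℂ} (h0 : x 0 = 0) (j : ℕ) : cpow x (j + 1) 0 = 0 := by
  rw [cpow_succ, cauchyProd_zero, h0, zero_mul]

end Powers

/-- **The exponential sequence** `expSeq x n = ∑_j (j!)⁻¹ (x^{⋆j}) n` — the coefficient sequence of
`exp (∑ x n tⁿ)` (`exp_ser`). [folklore] -/
def expSeq (x : ℕ → ℂ) (n : ℕ) : ℂ := ∑' j, ((j.factorial : ℂ))⁻¹ * cpow x j n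

section Exp

variable {σ : ℝ} {x : ℕ → ℂ}

/-- `∑_j wʲ/j! = eʷ` (real). [folklore] -/
theorem hasSum_pow_div_factorial (w : ℝ) : HasSum (fun j : ℕ => w ^ j / (j.factorial : ℝ)) (Real.exp w) := by
  have h := NormedSpace.exp_series_hasSum_exp' (𝕂 := ℝ) w
  rw [← Real.exp_eq_exp_ℝ] at h
  simpa [smul_eq_mul, div_eq_inv_mul] using h

/-- `∑_j wʲ/j! = eʷ` (complex). [folklore] -/
theorem hasSum_inv_factorial_mul_pow (w : ℂ) :
    HasSum (fun j : ℕ => ((j.factorial : ℂ))⁻¹ * w ^ j) (Complex.exp w) := by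
  have h := NormedSpace.exp_series_hasSum_exp' (𝕂 := ℂ) w
  rw [← Complex.exp_eq_exp_ℂ] at h
  simpa [smul_eq_mul] using h

/-- The terms of `expSeq x n` are dominated by `(wn σ x)ʲ/j! · σⁿ`. [folklore] -/
theorem norm_expSeq_term_le (hx : IsSumW σ x) (hσ : 0 < σ) (j n : ℕ) :
    ‖((j.factorial : ℂ))⁻¹ * cpow x j n‖ ≤ wn σ x ^ j / (j.factorial : ℝ) * σ ^ n := by
  rw [norm_mul, norm_inv, Complex.norm_natCast]
  calc ((j.factorial : ℝ))⁻¹ * ‖cpow x j n‖ ≤ ((j.factorial : ℝ))⁻¹ * (wn σ x ^ j * σ ^ n) :=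
        mul_le_mul_of_nonneg_left (norm_cpow_le hx hσ j n) (by positivity)
    _ = wn σ x ^ j / (j.factorial : ℝ) * σ ^ n := by ring

/-- The defining series of `expSeq x n` converges absolutely. [folklore] -/
theorem summable_norm_expSeq_term (hx : IsSumW σ x) (hσ : 0 < σ) (n : ℕ) :
    Summable fun j => ‖((j.factorial : ℂ))⁻¹ * cpow x j n‖ :=
  Summable.of_nonneg_of_le (fun _ => norm_nonneg _) (fun j => norm_expSeq_term_le hx hσ j n)
    ((hasSum_pow_div_factorial (wn σ x)).mul_right (σ ^ n)).summable

/-- The defining series of `expSeq x n` converges. [folklore] -/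
theorem summable_expSeq_term (hx : IsSumW σ x) (hσ : 0 < σ) (n : ℕ) :
    Summable fun j => ((j.factorial : ℂ))⁻¹ * cpow x j n :=
  (summable_norm_expSeq_term hx hσ n).of_norm

/-- The norm of `expSeq x n` is at most the sum of the norms of its terms. [folklore] -/
theorem norm_expSeq_le_tsum (hx : IsSumW σ x) (hσ : 0 < σ) (n : ℕ) :
    ‖expSeq x n‖ ≤ ∑' j, ‖((j.factorial : ℂ))⁻¹ * cpow x j n‖ :=
  norm_tsum_le_tsum_norm (summable_norm_expSeq_term hx hσ n)

/-- **Geometric bound for the exponential sequence**: `‖expSeq x n‖ ≤ e^{wn σ x} σⁿ`. [folklore] -/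
theorem isGeom_expSeq (hx : IsSumW σ x) (hσ : 0 < σ) : IsGeom σ (Real.exp (wn σ x)) (expSeq x) := by
  intro n
  have hreal : HasSum (fun j : ℕ => wn σ x ^ j / (j.factorial : ℝ) * σ ^ n) (Real.exp (wn σ x) * σ ^ n) :=
    (hasSum_pow_div_factorial (wn σ x)).mul_right (σ ^ n)
  have h2 : ∑' j, ‖((j.factorial : ℂ))⁻¹ * cpow x j n‖ ≤ ∑' j, wn σ x ^ j / (j.factorial : ℝ) * σ ^ n :=
    (summable_norm_expSeq_term hx hσ n).tsum_le_tsum (fun j => norm_expSeq_term_le hx hσ j n)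
      hreal.summable
  rw [hreal.tsum_eq] at h2
  exact (norm_expSeq_le_tsum hx hσ n).trans h2

/-- **First-order remainder**: `‖(expSeq x - δ₀) n‖ ≤ (e^{wn σ x} - 1) σⁿ`. [folklore] -/
theorem isGeom_expSeq_sub_delta (hx : IsSumW σ x) (hσ : 0 < σ) :
    IsGeom σ (Real.exp (wn σ x) - 1) (expSeq x - delta) := by
  intro n
  have hs := summable_expSeq_term hx hσ n
  have hsn := summable_norm_expSeq_term hx hσ n
  have h1 : (expSeq x - delta) n = ∑' j, (((j + 1).factorial : ℂ))⁻¹ * cpow x (j + 1) n := by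
    rw [Pi.sub_apply, expSeq, hs.tsum_eq_zero_add]
    simp only [Nat.factorial_zero, Nat.cast_one, inv_one, one_mul, cpow_zero, add_sub_cancel_left]
  have hreal : HasSum (fun j : ℕ => wn σ x ^ (j + 1) / ((j + 1).factorial : ℝ) * σ ^ n)
      ((Real.exp (wn σ x) - 1) * σ ^ n) := by
    have h := ((hasSum_nat_add_iff' 1).2 (hasSum_pow_div_factorial (wn σ x))).mul_right (σ ^ n)
    simpa using h
  rw [h1]
  have hsn' : Summable fun j => ‖(((j + 1).factorial : ℂ))⁻¹ * cpow x (j + 1) n‖ :=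
    (summable_nat_add_iff 1).2 hsn
  calc ‖∑' j, (((j + 1).factorial : ℂ))⁻¹ * cpow x (j + 1) n‖
      ≤ ∑' j, ‖(((j + 1).factorial : ℂ))⁻¹ * cpow x (j + 1) n‖ := norm_tsum_le_tsum_norm hsn'
    _ ≤ ∑' j, wn σ x ^ (j + 1) / ((j + 1).factorial : ℝ) * σ ^ n :=
        hsn'.tsum_le_tsum (fun j => norm_expSeq_term_le hx hσ (j + 1) n) hreal.summable
    _ = (Real.exp (wn σ x) - 1) * σ ^ n := hreal.tsum_eq

/-- `x^{⋆1} = x`. [folklore] -/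
@[simp] theorem cpow_one (x : ℕ → ℂ) : cpow x 1 = x := by
  rw [cpow_succ, cpow_zero, cauchyProd_delta_right]

/-- **Second-order remainder**: `‖(expSeq x - δ₀ - x) n‖ ≤ (e^{wn σ x} - 1 - wn σ x) σⁿ`. [folklore] -/
theorem isGeom_expSeq_sub_delta_sub (hx : IsSumW σ x) (hσ : 0 < σ) :
    IsGeom σ (Real.exp (wn σ x) - 1 - wn σ x) (expSeq x - delta - x) := by
  intro n
  have hs := summable_expSeq_term hx hσ n
  have hsn := summable_norm_expSeq_term hx hσ n
  have h1 : (expSeq x - delta - x) n = ∑' j, (((j + 2).factorial : ℂ))⁻¹ * cpow x (j + 2) n := by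
    rw [Pi.sub_apply, Pi.sub_apply, expSeq, hs.tsum_eq_zero_add,
      ((summable_nat_add_iff 1).2 hs).tsum_eq_zero_add]
    simp only [Nat.factorial_zero, Nat.factorial_one, Nat.cast_one, inv_one, one_mul, cpow_zero, cpow_one,
      zero_add]
    ring
  have hreal : HasSum (fun j : ℕ => wn σ x ^ (j + 2) / ((j + 2).factorial : ℝ) * σ ^ n)
      ((Real.exp (wn σ x) - (1 + wn σ x)) * σ ^ n) := by
    have h := ((hasSum_nat_add_iff' 2).2 (hasSum_pow_div_factorial (wn σ x))).mul_right (σ ^ n)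
    simpa [Finset.sum_range_succ] using h
  rw [h1]
  have hsn' : Summable fun j => ‖(((j + 2).factorial : ℂ))⁻¹ * cpow x (j + 2) n‖ :=
    (summable_nat_add_iff 2).2 hsn
  calc ‖∑' j, (((j + 2).factorial : ℂ))⁻¹ * cpow x (j + 2) n‖
      ≤ ∑' j, ‖(((j + 2).factorial : ℂ))⁻¹ * cpow x (j + 2) n‖ := norm_tsum_le_tsum_norm hsn'
    _ ≤ ∑' j, wn σ x ^ (j + 2) / ((j + 2).factorial : ℝ) * σ ^ n :=
        hsn'.tsum_le_tsum (fun j => norm_expSeq_term_le hx hσ (j + 2) n) hreal.summable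
    _ = (Real.exp (wn σ x) - (1 + wn σ x)) * σ ^ n := hreal.tsum_eq
    _ = (Real.exp (wn σ x) - 1 - wn σ x) * σ ^ n := by ring

/-- **`expSeq 0 = δ₀`.** [folklore] -/
@[simp] theorem expSeq_zero : expSeq (0 : ℕ → ℂ) = delta := by
  funext n
  rw [expSeq, tsum_eq_single 0]
  · simp
  · intro j hj
    obtain ⟨k, rfl⟩ := Nat.exists_eq_succ_of_ne_zero hj
    rw [cpow_zero_seq_succ]; simp

/-- **`expSeq x 0 = 1` when `x 0 = 0`** (only `j = 0` contributes). [folklore] -/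
theorem expSeq_apply_zero {x : ℕ → ℂ} (h0 : x 0 = 0) : expSeq x 0 = 1 := by
  rw [expSeq, tsum_eq_single 0]
  · simp
  · intro j hj
    obtain ⟨k, rfl⟩ := Nat.exists_eq_succ_of_ne_zero hj
    rw [cpow_apply_zero_of h0, mul_zero]

/-- The exponential sequence of a geometrically weighted sequence is absolutely summable (`σ < 1`). [folklore] -/
theorem summable_norm_expSeq (hx : IsSumW σ x) (hσ : 0 < σ) (hσ1 : σ < 1) :
    Summable fun n => ‖expSeq x n‖ :=
  Summable.of_nonneg_of_le (fun _ => norm_nonneg _) (isGeom_expSeq hx hσ)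
    ((summable_geometric_of_lt_one hσ.le hσ1).mul_left _)

end Exp

/-! ### The series `ser x θ = ∑ x n e^{inθ}` -/

/-- The **one-sided trigonometric series** `ser x θ = ∑_n x n e^{inθ}` of a coefficient sequence
(absolutely convergent for `x ∈ ℓ¹`). [folklore] -/
def ser (x : ℕ → ℂ) (θ : ℝ) : ℂ := ∑' n, x n * Complex.exp (θ * I) ^ n

section Ser

variable {x y : ℕ → ℂ}

/-- `|e^{iθ}| = 1`, powers included. [folklore] -/
theorem norm_exp_mul_I_pow (θ : ℝ) (n : ℕ) : ‖Complex.exp (θ * I) ^ n‖ = 1 := by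
  rw [norm_pow, Complex.norm_exp_ofReal_mul_I, one_pow]

/-- The terms of `ser x θ` have norm `‖x n‖`. [folklore] -/
theorem norm_ser_term (x : ℕ → ℂ) (θ : ℝ) (n : ℕ) : ‖x n * Complex.exp (θ * I) ^ n‖ = ‖x n‖ := by
  rw [norm_mul, norm_exp_mul_I_pow, mul_one]

/-- The terms of `ser x θ` are absolutely summable for `x ∈ ℓ¹`. [folklore] -/
theorem summable_norm_ser_term (hx : Summable fun n => ‖x n‖) (θ : ℝ) :
    Summable fun n => ‖x n * Complex.exp (θ * I) ^ n‖ :=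
  hx.congr fun n => (norm_ser_term x θ n).symm

/-- `ser x θ` is the sum of its series. [folklore] -/
theorem hasSum_ser (hx : Summable fun n => ‖x n‖) (θ : ℝ) :
    HasSum (fun n => x n * Complex.exp (θ * I) ^ n) (ser x θ) :=
  (summable_norm_ser_term hx θ).of_norm.hasSum

/-- **`ser x` is continuous** for `x ∈ ℓ¹` (uniform convergence). [folklore] -/
theorem continuous_ser (hx : Summable fun n => ‖x n‖) : Continuous (ser x) := by
  refine continuous_tsum (fun n => ?_) hx (fun n θ => (norm_ser_term x θ n).le)
  fun_prop

/-- `ser x` is `2π`-periodic. [folklore] -/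
theorem ser_periodic (x : ℕ → ℂ) : Function.Periodic (ser x) (2 * Real.pi) := by
  intro θ
  simp only [ser]
  refine tsum_congr fun n => ?_
  congr 2
  rw [show (((θ + 2 * Real.pi : ℝ)) : ℂ) * I = θ * I + 2 * Real.pi * I by push_cast; ring,
    Complex.exp_add, Complex.exp_two_pi_mul_I, mul_one]

/-- `ser` is additive. [folklore] -/
theorem ser_add (hx : Summable fun n => ‖x n‖) (hy : Summable fun n => ‖y n‖) (θ : ℝ) :
    ser (x + y) θ = ser x θ + ser y θ := by
  rw [ser, ser, ser, ← (summable_norm_ser_term hx θ).of_norm.tsum_add (summable_norm_ser_term hy θ).of_norm]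
  exact tsum_congr fun n => by rw [Pi.add_apply, add_mul]

/-- `ser` is homogeneous. [folklore] -/
theorem ser_smul (t : ℂ) (x : ℕ → ℂ) (θ : ℝ) : ser (t • x) θ = t * ser x θ := by
  rw [ser, ser, ← tsum_mul_left]
  exact tsum_congr fun n => by rw [Pi.smul_apply, smul_eq_mul, mul_assoc]

/-- `ser` commutes with subtraction. [folklore] -/
theorem ser_sub (hx : Summable fun n => ‖x n‖) (hy : Summable fun n => ‖y n‖) (θ : ℝ) :
    ser (x - y) θ = ser x θ - ser y θ := by
  rw [sub_eq_add_neg, ser_add hx (by simpa using hy), show -y = (-1 : ℂ) • y by simp, ser_smul]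
  ring

/-- `ser δ₀ = 1`. [folklore] -/
@[simp] theorem ser_delta (θ : ℝ) : ser delta θ = 1 := by
  rw [ser, tsum_eq_single 0]
  · simp
  · intro n hn; rw [delta_of_ne_zero hn, zero_mul]

/-- `ser 0 = 0`. [folklore] -/
@[simp] theorem ser_zero (θ : ℝ) : ser (0 : ℕ → ℂ) θ = 0 := by simp [ser]

/-- **`ser (x ⋆ y) = ser x · ser y`** (the Cauchy product of absolutely convergent series). [folklore] -/
theorem ser_cauchyProd (hx : Summable fun n => ‖x n‖) (hy : Summable fun n => ‖y n‖) (θ : ℝ) :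
    ser (cauchyProd x y) θ = ser x θ * ser y θ := by
  rw [ser, ser, ser, tsum_mul_tsum_eq_tsum_sum_antidiagonal_of_summable_norm
    (summable_norm_ser_term hx θ) (summable_norm_ser_term hy θ)]
  refine tsum_congr fun n => ?_
  rw [cauchyProd, sum_mul]
  refine sum_congr rfl fun kl hkl => ?_
  rw [mem_antidiagonal] at hkl
  rw [← hkl, pow_add]; ring

/-- `ser (x^{⋆j}) = (ser x)^j`. [folklore] -/
theorem ser_cpow (hx : Summable fun n => ‖x n‖) (θ : ℝ) (j : ℕ) : ser (cpow x j) θ = ser x θ ^ j := by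
  induction j with
  | zero => simp
  | succ j ih =>
    rw [cpow_succ, ser_cauchyProd hx (isSumW_one_iff.1 (isSumW_cpow (isSumW_one_iff.2 hx) one_pos j).1),
      ih, pow_succ']

/-- **`exp (ser x θ) = ser (expSeq x) θ`**: the exponential of an absolutely convergent one-sided
series is the series of the exponential sequence (rearrangement of the absolutely convergent double
series `∑_{j,n} (j!)⁻¹ x^{⋆j} n e^{inθ}`). [folklore] -/
theorem exp_ser (hx : Summable fun n => ‖x n‖) (θ : ℝ) : Complex.exp (ser x θ) = ser (expSeq x) θ := by
  have hx1 : IsSumW 1 x := isSumW_one_iff.2 hx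
  set z : ℂ := Complex.exp (θ * I) with hz
  set G : ℕ × ℕ → ℂ := fun p => ((p.1.factorial : ℂ))⁻¹ * (cpow x p.1 p.2 * z ^ p.2) with hG
  -- the double family is absolutely summable
  have hGs : Summable G := by
    refine Summable.of_norm ?_
    rw [summable_prod_of_nonneg (fun p => norm_nonneg _)]
    constructor
    · intro j
      have h := (isSumW_one_iff.1 (isSumW_cpow hx1 one_pos j).1).mul_left ((j.factorial : ℝ))⁻¹
      refine h.congr fun n => ?_
      simp only [hG, norm_mul, norm_inv, Complex.norm_natCast, hz, norm_exp_mul_I_pow, mul_one]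
    · have hmaj := (hasSum_pow_div_factorial (wn 1 x)).summable
      refine Summable.of_nonneg_of_le (fun j => tsum_nonneg fun n => norm_nonneg _) (fun j => ?_) hmaj
      have hcs := isSumW_one_iff.1 (isSumW_cpow hx1 one_pos j).1
      calc ∑' n, ‖G (j, n)‖ = ∑' n, ((j.factorial : ℝ))⁻¹ * ‖cpow x j n‖ := by
            refine tsum_congr fun n => ?_
            simp only [hG, norm_mul, norm_inv, Complex.norm_natCast, hz, norm_exp_mul_I_pow, mul_one]
        _ = ((j.factorial : ℝ))⁻¹ * ∑' n, ‖cpow x j n‖ := tsum_mul_left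
        _ ≤ ((j.factorial : ℝ))⁻¹ * wn 1 x ^ j := by
            refine mul_le_mul_of_nonneg_left ?_ (by positivity)
            rw [← wn_one]; exact (isSumW_cpow hx1 one_pos j).2
        _ = wn 1 x ^ j / (j.factorial : ℝ) := by ring
  -- both sides as iterated sums of `G`
  have hR : ser (expSeq x) θ = ∑' n, ∑' j, G (j, n) := by
    rw [ser]
    refine tsum_congr fun n => ?_
    rw [expSeq, ← tsum_mul_right]
    refine tsum_congr fun j => ?_
    simp only [hG, hz]; ring
  have hL : Complex.exp (ser x θ) = ∑' j, ∑' n, G (j, n) := by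
    rw [← (hasSum_inv_factorial_mul_pow (ser x θ)).tsum_eq]
    refine tsum_congr fun j => ?_
    rw [← ser_cpow hx θ j, ser, ← tsum_mul_left]
  rw [hL, hR]
  exact (Summable.tsum_comm (f := fun j n => G (j, n)) hGs).symm

end Ser

/-! ### Coefficient extraction and injectivity -/

section Coeff

variable {x y : ℕ → ℂ}

/-- **Orthogonality**: `∫_{-π}^{π} e^{imθ} dθ = 2π` if `m = 0` and `0` otherwise. [folklore] -/
theorem integral_exp_int_mul_I (m : ℤ) :
    (∫ θ in (-Real.pi)..Real.pi, Complex.exp ((m : ℂ) * θ * I)) =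
      if m = 0 then 2 * (Real.pi : ℂ) else 0 := by
  split_ifs with hm
  · subst hm; simp [two_mul]
  · have hc : (m : ℂ) * I ≠ 0 := mul_ne_zero (by exact_mod_cast hm) Complex.I_ne_zero
    have h := integral_exp_mul_complex (a := -Real.pi) (b := Real.pi) hc
    have hfun : (fun θ : ℝ => Complex.exp ((m : ℂ) * θ * I)) =
        fun θ : ℝ => Complex.exp ((m : ℂ) * I * θ) := by
      funext θ; ring_nf
    rw [hfun, h]
    have hper : Complex.exp ((m : ℂ) * I * Real.pi) = Complex.exp ((m : ℂ) * I * ↑(-Real.pi)) := by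
      have h1 := Complex.exp_int_mul_two_pi_mul_I m
      rw [show (m : ℂ) * I * Real.pi = (m : ℂ) * I * ↑(-Real.pi) + m * (2 * Real.pi * I) by
        push_cast; ring, Complex.exp_add, h1, mul_one]
    rw [hper, sub_self, zero_div]

/-- **Coefficient extraction**: the `m`-th Fourier coefficient of `ser x` is `x m` for `m ≥ 0` and
`0` for `m < 0` (termwise integration of the absolutely convergent series). [folklore] -/
theorem circleCoeff_ser (hx : Summable fun n => ‖x n‖) (m : ℤ) : circleCoeff (ser x) m = extendZ x m := by
  -- termwise integration
  have hterm : ∀ n : ℕ, (∫ θ in (-Real.pi)..Real.pi, Complex.exp (-(m * θ * I)) *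
      (x n * Complex.exp (θ * I) ^ n)) = x n * (if (n : ℤ) = m then 2 * (Real.pi : ℂ) else 0) := by
    intro n
    have hfun : (fun θ : ℝ => Complex.exp (-(m * θ * I)) * (x n * Complex.exp (θ * I) ^ n)) =
        fun θ : ℝ => x n * Complex.exp ((((n : ℤ) - m : ℤ) : ℂ) * θ * I) := by
      funext θ
      rw [← Complex.exp_nat_mul, mul_left_comm, ← Complex.exp_add]
      congr 2; push_cast; ring
    rw [hfun, intervalIntegral.integral_const_mul, integral_exp_int_mul_I]
    by_cases h : (n : ℤ) = m
    · rw [if_pos h, if_pos (sub_eq_zero.2 h)]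
    · rw [if_neg h, if_neg (sub_ne_zero.2 h)]
  have hsum : HasSum (fun n : ℕ => ∫ θ in (-Real.pi)..Real.pi, Complex.exp (-(m * θ * I)) *
      (x n * Complex.exp (θ * I) ^ n))
      (∫ θ in (-Real.pi)..Real.pi, Complex.exp (-(m * θ * I)) * ser x θ) := by
    refine intervalIntegral.hasSum_integral_of_dominated_convergence (fun n _ => ‖x n‖)
      (fun n => Continuous.aestronglyMeasurable (by fun_prop)) (fun n => ?_) ?_ ?_ ?_
    · refine Eventually.of_forall fun θ _ => ?_
      rw [norm_mul, norm_ser_term, show -((m : ℂ) * θ * I) = ((-(m * θ) : ℝ) : ℂ) * I by push_cast; ring,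
        Complex.norm_exp_ofReal_mul_I, one_mul]
    · exact Eventually.of_forall fun θ _ => hx
    · exact intervalIntegrable_const
    · exact Eventually.of_forall fun θ _ => (hasSum_ser hx θ).mul_left _
  simp_rw [hterm] at hsum
  rw [circleCoeff, hsum.tsum_eq.symm]
  have h2π : (2 * Real.pi : ℂ) ≠ 0 := by exact_mod_cast (mul_pos two_pos Real.pi_pos).ne'
  obtain ⟨k, rfl | rfl⟩ := Int.eq_nat_or_neg m
  · rw [extendZ_natCast, tsum_eq_single k]
    · simp only [if_true]; field_simp
    · intro n hn
      rw [if_neg (by exact_mod_cast hn), mul_zero]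
  · rcases Nat.eq_zero_or_pos k with rfl | hk
    · simp only [Nat.cast_zero, neg_zero]
      rw [show ((0 : ℤ)) = ((0 : ℕ) : ℤ) from rfl, extendZ_natCast, tsum_eq_single 0]
      · simp only [Nat.cast_zero, if_true]; field_simp
      · intro n hn
        rw [if_neg (by exact_mod_cast hn), mul_zero]
    · rw [extendZ_of_neg x (by omega)]
      have : (fun n : ℕ => x n * (if (n : ℤ) = -(k : ℤ) then 2 * (Real.pi : ℂ) else 0)) = fun _ => 0 := by
        funext n; rw [if_neg (by omega), mul_zero]
      rw [this, tsum_zero, mul_zero]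

/-- **Injectivity of `ser` on `ℓ¹`**: two absolutely summable one-sided sequences with the same
series coincide. [folklore] -/
theorem eq_of_ser_eq (hx : Summable fun n => ‖x n‖) (hy : Summable fun n => ‖y n‖)
    (h : ∀ θ, ser x θ = ser y θ) : x = y := by
  funext n
  have h1 := circleCoeff_ser hx n
  have h2 := circleCoeff_ser hy n
  rw [extendZ_natCast] at h1 h2
  rw [← h1, ← h2, show ser x = ser y from funext h]

end Coeff

/-! ### The group law of the exponential sequences -/

section GroupLaw

variable {σ : ℝ} {x : ℕ → ℂ}

/-- **`exp` turns scalar multiples into Cauchy products**: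
`expSeq (s • x) ⋆ expSeq (t • x) = expSeq ((s + t) • x)` — the coefficient form of
`e^{sV₊} e^{tV₊} = e^{(s+t)V₊}`. [folklore] -/
theorem cauchyProd_expSeq_smul (hx : IsSumW σ x) (hσ : 0 < σ) (hσ1 : σ < 1) (s t : ℂ) :
    cauchyProd (expSeq (s • x)) (expSeq (t • x)) = expSeq ((s + t) • x) := by
  have hs1 := summable_norm_expSeq (hx.smul s) hσ hσ1
  have ht1 := summable_norm_expSeq (hx.smul t) hσ hσ1
  have hst1 := summable_norm_expSeq (hx.smul (s + t)) hσ hσ1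
  have hx1 : Summable fun n => ‖x n‖ := hx.summable_norm hσ hσ1.le
  refine eq_of_ser_eq (summable_norm_cauchyProd hs1 ht1) hst1 fun θ => ?_
  rw [ser_cauchyProd hs1 ht1, ← exp_ser ((hx.smul s).summable_norm hσ hσ1.le),
    ← exp_ser ((hx.smul t).summable_norm hσ hσ1.le), ← exp_ser ((hx.smul (s + t)).summable_norm hσ hσ1.le),
    ser_smul, ser_smul, ser_smul, ← Complex.exp_add]
  congr 1; ring

/-- `expSeq (s • x) ⋆ expSeq (-s • x) = δ₀`: the exponential sequences are Cauchy-invertible. [folklore] -/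
theorem cauchyProd_expSeq_smul_neg (hx : IsSumW σ x) (hσ : 0 < σ) (hσ1 : σ < 1) (s : ℂ) :
    cauchyProd (expSeq (s • x)) (expSeq ((-s) • x)) = delta := by
  rw [cauchyProd_expSeq_smul hx hσ hσ1, add_neg_cancel, zero_smul, expSeq_zero]

end GroupLaw

end Literature.Analysis.Toeplitz
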